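import Mathlib
import Summits.NavierStokesRegularity.FluidComputer.SkewCutGalerkinMaster

/-!
# Skew-cut certificate: finite-section matrix eigenpairs ARE Galerkin data (glue, diagonal /
Hilbert-basis setting)
(instab4 g4 — implementation 2 of the skew-cut X0 certifier, cell `ns-blowup`, 2026-08-26)

HONEST FRAMING (human ruling D-0035): nothing here is a claim about Navier–Stokes blow-up.
WHAT THIS IS NOT: not NS evidence. MODEL lane. The kernel statements of implementation 1
(`SkewCutSchurCoercivity.exists_eigenvalue_of_certificate`, instab3) deliver, for every finer truncation
`F ⊇ head`, a MATRIX eigenpair of the finite section `[ℓ_i δ_ij + a_ij]_{i,j ∈ F}` with eigenvalue in the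
bracket; `SkewCutGalerkinMaster.exists_smooth_eigenvector_Ioo` (g4) consumes GALERKIN DATA
`u ∈ Ū_F`, `v = S₀ u`, `P_F (x₀ v − u + T u) = x v`. This file is the dictionary between the two in the
diagonal setting (`S₀ = diag(d)`, `d_i (x₀ − ℓ_i) = 1`, `a_ij = ⟪b i, T b j⟫ (x₀ − ℓ_j)`):

* `galerkin_datum_of_section_eigenpair`: coefficients `c` on a finite `F` with
  `ℓ_i c_i + Σ_{j∈F} a_ij c_j = x c_i` (`i ∈ F`) give `u := Σ_{j∈F} ((x₀ − ℓ_j) c_j) b_j ∈ span(b '' F)`,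
  `S₀ u = Σ_{j∈F} c_j b_j`, and the section eigen-equation `P_F (x₀ S₀ u − u + T u) = x S₀ u`;
* `norm_sq_sum_smul_basis`: `‖Σ_{j∈F} c_j b_j‖² = Σ_{j∈F} ‖c_j‖²` (normalisation / graph-norm bookkeeping).

So the hypotheses `hu, hv1, hC, hGal` of the master theorem reduce to: matrix eigenpairs of the
sections normalised to `Σ|c_j|² = 1`, and a uniform bound `Σ_F |x₀ − ℓ_j|²|c_j|² ≤ C²` (the H²/graph
norm of instab3's `SkewCutGalerkinBounds.graph_bound`, up to `‖(1 − T)⁻¹‖`). What stays model-specific: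
that the certifier's matrices are `[ℓ δ + a]` (assembly).

Mathlib + `SkewCutGalerkinMaster`; no new definitions.
-/

noncomputable section

namespace Summit.NavierStokesRegularity.FluidComputer.SkewCutGalerkinSections

open Submodule
open scoped InnerProductSpace

variable {𝕜 H : Type*} [RCLike 𝕜] [NormedAddCommGroup H] [InnerProductSpace 𝕜 H]
variable {ι : Type*} (b : HilbertBasis ι 𝕜 H)

/-- Coordinates of a finite combination of basis vectors: `⟪b i, Σ_{j∈F} α_j b_j⟫ = α_i` on `F`,
`0` off `F`. -/
theorem inner_basis_sum_smul [DecidableEq ι] (F : Finset ι) (α : ι → 𝕜) (i : ι) :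
    ⟪b i, ∑ j ∈ F, α j • b j⟫_𝕜 = if i ∈ F then α i else 0 := by
  split_ifs with hi
  · exact b.orthonormal.inner_right_sum α hi
  · rw [inner_sum]
    refine Finset.sum_eq_zero fun j hj => ?_
    rw [inner_smul_right, (orthonormal_iff_ite.mp b.orthonormal) i j,
      if_neg (fun h : i = j => hi (h ▸ hj)), mul_zero]

/-- `‖Σ_{j∈F} c_j b_j‖² = Σ_{j∈F} ‖c_j‖²`. -/
theorem norm_sq_sum_smul_basis [DecidableEq ι] (F : Finset ι) (c : ι → 𝕜) :
    ‖∑ j ∈ F, c j • b j‖ ^ 2 = ∑ j ∈ F, ‖c j‖ ^ 2 := by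
  rw [@norm_sq_eq_re_inner 𝕜, inner_sum, map_sum]
  refine Finset.sum_congr rfl fun j hj => ?_
  rw [inner_smul_right, ← inner_conj_symm, inner_basis_sum_smul b F c j, if_pos hj, RCLike.mul_conj,
    ← RCLike.ofReal_pow, RCLike.ofReal_re]

/-- Basis vectors off `F` are orthogonal to the closed span of those on `F`. -/
theorem basis_mem_orthogonal_closure_span [CompleteSpace H] (F : Finset ι) {i : ι} (hi : i ∉ F) :
    b i ∈ ((span 𝕜 (b '' (F : Set ι))).topologicalClosure)ᗮ := by
  classical
  rw [← orthogonal_orthogonal_eq_closure, triorthogonal_eq_orthogonal, mem_orthogonal]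
  intro u hu
  refine span_induction (p := fun y _ => ⟪y, b i⟫_𝕜 = 0) (fun y hy => ?_) (inner_zero_left _)
    (fun y z _ _ hy hz => ?_) (fun c y _ hy => ?_) hu
  · obtain ⟨j, hj, rfl⟩ := hy
    rw [(orthonormal_iff_ite.mp b.orthonormal) j i, if_neg (fun h : j = i => hi (h ▸ hj))]
  · rw [inner_add_left, hy, hz, add_zero]
  · rw [inner_smul_left, hy, mul_zero]

/-- **Section matrix eigenpair ⇒ Galerkin datum.** With `a_ij := ⟪b i, T b j⟫ (x₀ − ℓ_j)` and
`d_i (x₀ − ℓ_i) = 1`: if `ℓ_i c_i + Σ_{j∈F} a_ij c_j = x c_i` for `i ∈ F` (finite `F`), then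
`u := Σ_{j∈F} ((x₀ − ℓ_j) c_j) • b_j` lies in the truncation, `S₀ u = Σ_{j∈F} c_j • b_j`, and
`P_F (x₀ S₀ u − u + T u) = x S₀ u`. -/
theorem galerkin_datum_of_section_eigenpair [CompleteSpace H] [DecidableEq ι] (ℓ : ι → ℝ) (x₀ : ℝ)
    (d : lp (fun _ : ι => 𝕜) ⊤) (hd : ∀ i, d i * ((x₀ : 𝕜) - (ℓ i : 𝕜)) = 1) (T : H →L[𝕜] H)
    (F : Finset ι) (c : ι → 𝕜) (x : 𝕜)
    (heig : ∀ i ∈ F, (ℓ i : 𝕜) * c i +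
      ∑ j ∈ F, (⟪b i, T (b j)⟫_𝕜 * ((x₀ : 𝕜) - (ℓ j : 𝕜))) * c j = x * c i) :
    (∑ j ∈ F, (((x₀ : 𝕜) - (ℓ j : 𝕜)) * c j) • b j) ∈
        (span 𝕜 (b '' (F : Set ι))).topologicalClosure ∧
      b.diagonalCLM d (∑ j ∈ F, (((x₀ : 𝕜) - (ℓ j : 𝕜)) * c j) • b j) = ∑ j ∈ F, c j • b j ∧
      (span 𝕜 (b '' (F : Set ι))).topologicalClosure.starProjection
          ((x₀ : 𝕜) • b.diagonalCLM d (∑ j ∈ F, (((x₀ : 𝕜) - (ℓ j : 𝕜)) * c j) • b j) -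
            (∑ j ∈ F, (((x₀ : 𝕜) - (ℓ j : 𝕜)) * c j) • b j) +
            T (∑ j ∈ F, (((x₀ : 𝕜) - (ℓ j : 𝕜)) * c j) • b j)) =
        x • b.diagonalCLM d (∑ j ∈ F, (((x₀ : 𝕜) - (ℓ j : 𝕜)) * c j) • b j) := by
  set u : H := ∑ j ∈ F, (((x₀ : 𝕜) - (ℓ j : 𝕜)) * c j) • b j with hu
  set v : H := ∑ j ∈ F, c j • b j with hv
  set U : Submodule 𝕜 H := (span 𝕜 (b '' (F : Set ι))).topologicalClosure with hU
  -- membership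
  have huU' : u ∈ span 𝕜 (b '' (F : Set ι)) :=
    sum_mem fun j hj => smul_mem _ _ (subset_span ⟨j, hj, rfl⟩)
  have hvU' : v ∈ span 𝕜 (b '' (F : Set ι)) :=
    sum_mem fun j hj => smul_mem _ _ (subset_span ⟨j, hj, rfl⟩)
  have huU : u ∈ U := (span 𝕜 (b '' (F : Set ι))).le_topologicalClosure huU'
  have hvU : v ∈ U := (span 𝕜 (b '' (F : Set ι))).le_topologicalClosure hvU'
  -- `S₀ u = v` by coordinates
  have hS₀u : b.diagonalCLM d u = v := by
    apply b.repr.injective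
    ext i
    rw [b.diagonalCLM_apply_repr, b.repr_apply_apply, b.repr_apply_apply, hu, hv,
      inner_basis_sum_smul, inner_basis_sum_smul]
    split_ifs with hi
    · rw [← mul_assoc, hd, one_mul]
    · rw [mul_zero]
  refine ⟨huU, hS₀u, ?_⟩
  rw [hS₀u]
  -- the eigen-equation by coordinates
  set P := U.starProjection with hP
  apply b.repr.injective
  ext i
  rw [b.repr_apply_apply, b.repr_apply_apply, ← inner_starProjection_left_eq_right]
  by_cases hi : i ∈ F
  · have hbi : P (b i) = b i := starProjection_eq_self_iff.2
      ((span 𝕜 (b '' (F : Set ι))).le_topologicalClosure (subset_span ⟨i, hi, rfl⟩))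
    rw [hbi, inner_add_right, inner_sub_right, inner_smul_right, inner_smul_right, hv, hu,
      inner_basis_sum_smul, inner_basis_sum_smul, if_pos hi, if_pos hi, map_sum, inner_sum]
    have hT : ∑ j ∈ F, ⟪b i, T ((((x₀ : 𝕜) - (ℓ j : 𝕜)) * c j) • b j)⟫_𝕜 =
        ∑ j ∈ F, (⟪b i, T (b j)⟫_𝕜 * ((x₀ : 𝕜) - (ℓ j : 𝕜))) * c j :=
      Finset.sum_congr rfl fun j _ => by rw [map_smul, inner_smul_right]; ring
    rw [hT, ← heig i hi]
    ring
  · have hbi : P (b i) = 0 :=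
      (starProjection_apply_eq_zero_iff U).2 (basis_mem_orthogonal_closure_span b F hi)
    rw [hbi, inner_zero_left, inner_smul_right, hv, inner_basis_sum_smul, if_neg hi, mul_zero]

end Summit.NavierStokesRegularity.FluidComputer.SkewCutGalerkinSections

end
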